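import Summits.HodgeConjecture.HodgeConjecture.Theorems.F0P6aSigmaGAL   -- ★ p850253 twin (part B; part A = ★ `Theorems.F0P6aSigmaGALSockets` p850230) of ED. 1 44b59a9cab2fb912 (namespace KEPT ⇒ every FQN unchanged)
import HarnessLib

/-! # F0_P6a_SigmaGAL — ED. 2 = SHIM (rung-0 re-home; LEAD «M-72» (4) ∕ «M-78» CLASS III, «K3» sweep; dealer «L7» LA7-plan (g4→g5); hand A-p14 (g39) on desk F0P6a-plan (g5)'s plate 09:18:55Z, RE-HOME TABLE v1.3.1 row 21)

The 10 declarations of ED. 1 (sha16 44b59a9cab2fb912, 611 l., sorry-free: `ReadsCGalois`, `ReadsCReading`, `KCMInputs`, `kcm_chain_of_cm_recip`,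
`exists_artin_twist_classes`, `stub_KCM`, `map_toFun_eq_mapMatrix_of_readings`, `exists_fieldPoint_fibre_comp_galA_eq`, `readsCGalois_of_readsCReading`,
head `sigmaGAL_of_stub`) now live, byte for byte and under the SAME namespace `Summit.HodgeConjecture.HodgeConjecture.Cruxes.HLiu418.F0P6aSigmaGAL`,
in the ★ pair `Theorems/F0P6aSigmaGALSockets.lean` (p850230, §Sockets–§KCMPayment) + `Theorems/F0P6aSigmaGAL.lean` (p850253, §TorusReading–§Head; it
imports the former and ★ `Theorems.F0P6aPELWitnessEDefs` p850070 for `AuxChartGS`) — RE-HOME TABLE v1.3.1 row 21, no cut decl (nothing to alias).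
This module keeps its name so that its ONE importer (`rg` 09:30Z: `Lines/F0_P6a_StubE6.lean` l. 1) and by-name readers resolve unchanged through the
import above; it declares nothing.  ORDER NOTE: written together with ∕ after the `F0_P6a_PELWitnessEDefs` shim (row 20, ED. 6) — ED. 1 imported
`Lines.F0_P6a_PELWitnessEDefs` while the ★ twin imports `Theorems.F0P6aPELWitnessEDefs`, so the (D) declarations must have ONE home when this import
lands (same note as rows 19∕20∕23; the chain SigmaGAL ← StubE6 ← PELWitnessE ← {PELInputs, StubKOTT} is serial inside the 33-cone, one request, lake
orders).  Edition history ED. 1 stays in the line card and in git; future changes are ★-side proposals on the `Theorems/` files.  HC_CM is proved only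
modulo the 7 printed citations (2 remaining named inputs: hLiu418 = stmt-HodgeConjecture-24832, h413 = stmt-HodgeConjecture-24833) until rung 0 closes;
count-neutral (0 `sorry`, 0 socket, 0 declaration). -/
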